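import Literature.AlgebraicGeometry.HodgeTheory.FermatDiagonalAction
import Literature.AlgebraicGeometry.HodgeTheory.CompleteIntersectionHilbertFunctionSign
import HarnessLib

/-!
# Admissible Fermat characters versus Jacobian box monomials, refined by a sign character
# (route `SignSymmetricPowers`, item stmt-HodgeConjecture-19716; cell `hodge-nonav`)

Prover seat `hodge-nonav-19716-p2` (g5). Landed `--supports stmt-HodgeConjecture-19716 --as helper`; sorry-free, no
definition, no named fact. Pure finite combinatorics used by the discharge, modulo the geometric genus, of the binder
hV (`voisin2003_finrank_eigenspace_inf_hodgePiece_of_diagonalStabilizer`) of crux K1-B `VeryGeneralSignCommutatorsInHg`.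

Shioda 1979 §1 (1.7) identifies the character line `V(α)`, `α = (a₀, …, a₄) ∈ 𝔄³_d` (all `aᵢ ∈ ℤ/d ∖ 0`, `Σ aᵢ = 0`),
of `H³` of the Fermat threefold `X³_d` with the residue of the Jacobian monomial `x^β`, `βᵢ = ⟨aᵢ⟩ − 1 ∈ [0, d−2]`, of
degree `|β| = Σ⟨aᵢ⟩ − 5 = (q+1)d − 5`, `q + 1 = Σ⟨aᵢ⟩/d ∈ {1, 2, 3, 4}` (Griffiths; Carlson–Müller-Stach–Peters §7.4).
For a diagonal symmetry `a ∈ μ_d⁵` with `∏ aᵢ = 1` the character value `χ_α(a) = ∏ aᵢ^{⟨αᵢ⟩}` is the monomial weight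
`a^β`. Hence, as pure counting statements (no cohomology):

* `card_boxFilter_eq_of_add_eq` — the box count `#{β ∈ [0, d−2]^N : |β| = t, a^β = c}` is symmetric under
  `t ↦ N(d−2) − t` for a sign vector `a` (`a² = 1`) with `∏ aᵢ^{d−2} = 1` (complement `β ↦ (d−2) − β`);
  `card_boxFilter_eq_zero_of_lt` — and vanishes for `t > N(d−2)`.
* `card_admissible_character_eq_sum_boxFilter` — for `a ∈ μ_d⁵` with `∏ aᵢ = 1` and `d ≥ 2`:
  `#{α ∈ 𝔄³_d : χ_α(a) = c} = Σ_{q < 4, (q+1)d ≥ 5} #{β ∈ [0, d−2]⁵ : |β| = (q+1)d − 5, a^β = c}`.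

## References

* [Shioda1979HodgeFermat] T. Shioda, The Hodge conjecture for Fermat varieties, Math. Ann. 245 (1979), §1 (1.7).
* [CarlsonMullerStachPeters2017] J. Carlson, S. Müller-Stach, C. Peters, Period Mappings and Period Domains (2nd ed.
  2017), §7.4 Thm. 7.4.1.
-/

noncomputable section

open Finset MvPolynomial
open Literature.AlgebraicGeometry.HodgeTheory

-- mandated namespace `Summit.HodgeConjecture.HodgeConjecture.Theorems` trips `linter.dupNamespace` (off tree-wide)
set_option linter.dupNamespace false

namespace Summit.HodgeConjecture.HodgeConjecture.Theorems.SignSymmetricPowersSignFermatCount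

/-! ### §1 The box count and its complement symmetry -/

/-- For a sign vector (`a * a = 1`), `aᵢ^{m − e} = aᵢ^m · aᵢ^e` for `e ≤ m` (since `aᵢ^{2e} = 1`).
[cite: CarlsonMullerStachPeters2017, §7.4 Thm. 7.4.1] -/
theorem pow_sub_eq_pow_mul_pow_of_mul_self {N : ℕ} {a : Fin N → ℂˣ} (ha : a * a = 1) (i : Fin N) {m e : ℕ}
    (he : e ≤ m) : ((a i : ℂˣ) : ℂ) ^ (m - e) = ((a i : ℂˣ) : ℂ) ^ m * ((a i : ℂˣ) : ℂ) ^ e := by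
  have hai : ((a i : ℂˣ) : ℂ) * ((a i : ℂˣ) : ℂ) = 1 := by
    have h := congrFun ha i
    simp only [Pi.mul_apply, Pi.one_apply] at h
    rw [← Units.val_mul, h, Units.val_one]
  have hsq : (((a i : ℂˣ) : ℂ) ^ e) * (((a i : ℂˣ) : ℂ) ^ e) = 1 := by
    rw [← mul_pow, hai, one_pow]
  calc ((a i : ℂˣ) : ℂ) ^ (m - e) = ((a i : ℂˣ) : ℂ) ^ (m - e) * ((((a i : ℂˣ) : ℂ) ^ e) * (((a i : ℂˣ) : ℂ) ^ e)) := by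
        rw [hsq, mul_one]
    _ = ((a i : ℂˣ) : ℂ) ^ (m - e + e) * ((a i : ℂˣ) : ℂ) ^ e := by rw [pow_add, mul_assoc]
    _ = ((a i : ℂˣ) : ℂ) ^ m * ((a i : ℂˣ) : ℂ) ^ e := by rw [Nat.sub_add_cancel he]

/-- **Complement symmetry of the sign-refined box count**: for a sign vector `a` (`a * a = 1`) with
`∏ aᵢ^{d−2} = 1` and `t + t' = N(d−2)`, `#{β ∈ [0,d−2]^N : |β| = t, a^β = c} = #{β ∈ [0,d−2]^N : |β| = t', a^β = c}`
(the involution `β ↦ (d−2) − β` of the box; Macaulay duality of the complete-intersection Hilbert function, refined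
by the character). [cite: CarlsonMullerStachPeters2017, §7.4 Thm. 7.4.1] -/
theorem card_boxFilter_eq_of_add_eq {N d : ℕ} {a : Fin N → ℂˣ} (ha : a * a = 1)
    (hprod : ∏ i, ((a i : ℂˣ) : ℂ) ^ (d - 2) = 1) (c : ℂ) {t t' : ℕ} (htt' : t + t' = N * (d - 2)) :
    (((univ : Finset (Fin N)).finsuppAntidiag t).filter
        fun β : Fin N →₀ ℕ ↦ (∀ i, β i ≤ d - 2) ∧ (∏ i, ((a i : ℂˣ) : ℂ) ^ β i) = c).card =
      (((univ : Finset (Fin N)).finsuppAntidiag t').filter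
        fun β : Fin N →₀ ℕ ↦ (∀ i, β i ≤ d - 2) ∧ (∏ i, ((a i : ℂˣ) : ℂ) ^ β i) = c).card := by
  classical
  -- the complement involution
  set cpl : (Fin N →₀ ℕ) → (Fin N →₀ ℕ) := fun β ↦ Finsupp.equivFunOnFinite.symm fun i ↦ d - 2 - β i with hcpl
  have hcpl_apply : ∀ β i, cpl β i = d - 2 - β i := fun β i ↦ by simp [hcpl]
  have hcpl_cpl : ∀ β : Fin N →₀ ℕ, (∀ i, β i ≤ d - 2) → cpl (cpl β) = β := fun β hβ ↦ by
    ext i; rw [hcpl_apply, hcpl_apply]; have := hβ i; omega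
  have hsum_cpl : ∀ β : Fin N →₀ ℕ, (∀ i, β i ≤ d - 2) → ∀ {s : ℕ}, ∑ i, β i = s →
      ∑ i, cpl β i = N * (d - 2) - s := by
    intro β hβ s hs
    have h : ∑ i, cpl β i + ∑ i, β i = N * (d - 2) := by
      rw [← Finset.sum_add_distrib]
      calc ∑ i, (cpl β i + β i) = ∑ _i : Fin N, (d - 2) :=
            Finset.sum_congr rfl fun i _ ↦ by rw [hcpl_apply]; have := hβ i; omega
        _ = N * (d - 2) := by rw [Finset.sum_const, Finset.card_univ, Fintype.card_fin, smul_eq_mul]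
    omega
  have hprod_cpl : ∀ β : Fin N →₀ ℕ, (∀ i, β i ≤ d - 2) →
      (∏ i, ((a i : ℂˣ) : ℂ) ^ cpl β i) = ∏ i, ((a i : ℂˣ) : ℂ) ^ β i := by
    intro β hβ
    calc (∏ i, ((a i : ℂˣ) : ℂ) ^ cpl β i) = ∏ i, (((a i : ℂˣ) : ℂ) ^ (d - 2) * ((a i : ℂˣ) : ℂ) ^ β i) :=
          Finset.prod_congr rfl fun i _ ↦ by rw [hcpl_apply, pow_sub_eq_pow_mul_pow_of_mul_self ha i (hβ i)]
      _ = ∏ i, ((a i : ℂˣ) : ℂ) ^ β i := by rw [Finset.prod_mul_distrib, hprod, one_mul]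
  have hmem : ∀ {s s' : ℕ}, s + s' = N * (d - 2) → ∀ β : Fin N →₀ ℕ,
      β ∈ ((univ : Finset (Fin N)).finsuppAntidiag s).filter
        (fun β : Fin N →₀ ℕ ↦ (∀ i, β i ≤ d - 2) ∧ (∏ i, ((a i : ℂˣ) : ℂ) ^ β i) = c) →
      cpl β ∈ ((univ : Finset (Fin N)).finsuppAntidiag s').filter
        (fun β : Fin N →₀ ℕ ↦ (∀ i, β i ≤ d - 2) ∧ (∏ i, ((a i : ℂˣ) : ℂ) ^ β i) = c) := by
    intro s s' hss' β hβ
    simp only [mem_filter, mem_finsuppAntidiag, subset_univ, and_true] at hβ ⊢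
    obtain ⟨hs, hle, hc⟩ := hβ
    refine ⟨?_, fun i ↦ by rw [hcpl_apply]; omega, by rw [hprod_cpl β hle, hc]⟩
    rw [hsum_cpl β hle hs]; omega
  refine card_nbij' cpl cpl (fun β hβ ↦ hmem htt' β hβ) (fun β hβ ↦ hmem (by omega) β hβ)
    (fun β hβ ↦ hcpl_cpl β ?_) (fun β hβ ↦ hcpl_cpl β ?_)
  · exact ((mem_filter.mp hβ).2).1
  · exact ((mem_filter.mp hβ).2).1

/-- **The box is empty above its top degree**: `#{β ∈ [0,d−2]^N : |β| = t, …} = 0` for `t > N(d−2)`.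
[cite: CarlsonMullerStachPeters2017, §7.4 Thm. 7.4.1] -/
theorem card_boxFilter_eq_zero_of_lt {N d : ℕ} (a : Fin N → ℂˣ) (c : ℂ) {t : ℕ} (ht : N * (d - 2) < t) :
    (((univ : Finset (Fin N)).finsuppAntidiag t).filter
        fun β : Fin N →₀ ℕ ↦ (∀ i, β i ≤ d - 2) ∧ (∏ i, ((a i : ℂˣ) : ℂ) ^ β i) = c).card = 0 := by
  rw [Finset.card_eq_zero, Finset.filter_eq_empty_iff]
  intro β hβ hcond
  obtain ⟨hle, -⟩ := hcond
  rw [mem_finsuppAntidiag] at hβ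
  have h : (univ : Finset (Fin N)).sum ⇑β ≤ N * (d - 2) := by
    calc ∑ i, β i ≤ ∑ _i : Fin N, (d - 2) := Finset.sum_le_sum fun i _ ↦ hle i
      _ = N * (d - 2) := by rw [Finset.sum_const, Finset.card_univ, Fintype.card_fin, smul_eq_mul]
  have h' : (univ : Finset (Fin N)).sum ⇑β = t := hβ.1
  omega

/-! ### §2 Admissible characters of `μ_d⁵` versus box monomials -/

/-- The exponent vector `β(α) = (⟨αᵢ⟩ − 1)ᵢ` of a character `α ∈ (ℤ/d)⁵` (Shioda's dictionary (1.7)).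
[cite: Shioda1979HodgeFermat, §1 (1.7)] -/
theorem equivFunOnFinite_symm_apply' {d : ℕ} (α : Fin (3 + 2) → ZMod d) (i : Fin (3 + 2)) :
    (Finsupp.equivFunOnFinite.symm fun k ↦ (α k).val - 1 : Fin (3 + 2) →₀ ℕ) i = (α i).val - 1 := by
  simp

/-- **`#{α ∈ 𝔄³_d : χ_α(a) = c} = Σ_{q<4, (q+1)d ≥ 5} #{β ∈ [0,d−2]⁵ : |β| = (q+1)d − 5, a^β = c}`** for `a ∈ μ_d⁵` with
`∏ aᵢ = 1` (`d ≥ 2`): Shioda's dictionary `α ↦ β = (⟨αᵢ⟩ − 1)ᵢ` between admissible characters (all `αᵢ ≠ 0`,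
`Σ αᵢ = 0`, i.e. `Σ⟨αᵢ⟩ = (q+1)d`, `1 ≤ q+1 ≤ 4`) and the Jacobian box monomials of the Fermat quintic form in degrees
`(q+1)d − 5`, under which `χ_α(a) = ∏ aᵢ^{⟨αᵢ⟩} = (∏ aᵢ) · a^β = a^β`. [cite: Shioda1979HodgeFermat, §1 (1.7)]
[cite: CarlsonMullerStachPeters2017, §7.4 Thm. 7.4.1] -/
theorem card_admissible_character_eq_sum_boxFilter {d : ℕ} [NeZero d] (h2 : 2 ≤ d) (a : fermatGroup 3 d)
    (hprod : ∏ i, (((a : Fin (3 + 2) → ℂˣ) i : ℂˣ) : ℂ) = 1) (c : ℂ) :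
    Fintype.card {α : Fin (3 + 2) → ZMod d //
        ((fermatCharacter d α a : ℂˣ) : ℂ) = c ∧ (∀ i, α i ≠ 0) ∧ ∑ i, α i = 0} =
      ∑ q ∈ Finset.range 4, if (q + 1) * d < 5 then 0 else
        (((univ : Finset (Fin (3 + 2))).finsuppAntidiag ((q + 1) * d - 5)).filter
          fun β : Fin (3 + 2) →₀ ℕ ↦ (∀ i, β i ≤ d - 2) ∧
            (∏ i, (((a : Fin (3 + 2) → ℂˣ) i : ℂˣ) : ℂ) ^ β i) = c).card := by
  classical
  have hd0 : 0 < d := by omega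
  -- the two maps of Shioda's dictionary
  set toβ : (Fin (3 + 2) → ZMod d) → (Fin (3 + 2) →₀ ℕ) :=
    fun α ↦ Finsupp.equivFunOnFinite.symm fun k ↦ (α k).val - 1 with htoβ
  set toα : (Fin (3 + 2) →₀ ℕ) → (Fin (3 + 2) → ZMod d) := fun β k ↦ ((β k + 1 : ℕ) : ZMod d) with htoα
  have htoβ_apply : ∀ α i, toβ α i = (α i).val - 1 := fun α i ↦ by simp [htoβ]
  have htoα_apply : ∀ β i, toα β i = ((β i + 1 : ℕ) : ZMod d) := fun β i ↦ rfl
  -- values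
  have hval_pos : ∀ {x : ZMod d}, x ≠ 0 → 1 ≤ x.val := fun hx ↦ ZMod.val_pos.mpr hx
  have hval_lt : ∀ x : ZMod d, x.val < d := fun x ↦ ZMod.val_lt x
  have hval_toα : ∀ (β : Fin (3 + 2) →₀ ℕ) (i), β i ≤ d - 2 → (toα β i).val = β i + 1 := fun β i hβ ↦ by
    rw [htoα_apply, ZMod.val_natCast, Nat.mod_eq_of_lt (by omega)]
  have htoα_ne : ∀ (β : Fin (3 + 2) →₀ ℕ) (i), β i ≤ d - 2 → toα β i ≠ 0 := fun β i hβ h0 ↦ by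
    have h := hval_toα β i hβ
    rw [h0, ZMod.val_zero] at h
    omega
  -- the character in terms of `β`: `χ_α(a) = ∏ aᵢ^{βᵢ+1} = a^β`
  have hchar : ∀ α : Fin (3 + 2) → ZMod d, (∀ i, α i ≠ 0) →
      ((fermatCharacter d α a : ℂˣ) : ℂ) = ∏ i, (((a : Fin (3 + 2) → ℂˣ) i : ℂˣ) : ℂ) ^ toβ α i := by
    intro α hα
    rw [fermatCharacter_apply, Units.coe_prod]
    simp_rw [Units.val_pow_eq_pow_val]
    calc ∏ i, (((a : Fin (3 + 2) → ℂˣ) i : ℂˣ) : ℂ) ^ (α i).val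
        = ∏ i, ((((a : Fin (3 + 2) → ℂˣ) i : ℂˣ) : ℂ) ^ toβ α i * (((a : Fin (3 + 2) → ℂˣ) i : ℂˣ) : ℂ)) :=
          Finset.prod_congr rfl fun i _ ↦ by
            rw [← pow_succ, htoβ_apply, Nat.sub_add_cancel (hval_pos (hα i))]
      _ = ∏ i, (((a : Fin (3 + 2) → ℂˣ) i : ℂˣ) : ℂ) ^ toβ α i := by
          rw [Finset.prod_mul_distrib, hprod, mul_one]
  -- sums: `Σ ⟨αᵢ⟩ = |β| + 5`, and `Σ αᵢ = 0 ↔ d ∣ Σ ⟨αᵢ⟩`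
  have hsumval : ∀ α : Fin (3 + 2) → ZMod d, (∀ i, α i ≠ 0) → ∑ i, (α i).val = ∑ i, toβ α i + 5 := by
    intro α hα
    have h : ∀ i, (α i).val = toβ α i + 1 := fun i ↦ by rw [htoβ_apply, Nat.sub_add_cancel (hval_pos (hα i))]
    simp_rw [h]
    rw [Finset.sum_add_distrib, Finset.sum_const, Finset.card_univ, Fintype.card_fin, smul_eq_mul]
  have hsum0 : ∀ α : Fin (3 + 2) → ZMod d, ∑ i, α i = 0 ↔ d ∣ ∑ i, (α i).val := by
    intro α
    rw [← ZMod.natCast_eq_zero_iff, Nat.cast_sum]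
    simp_rw [ZMod.natCast_zmod_val]
  -- the right-hand side as ONE finset
  set T : Finset (Fin (3 + 2) →₀ ℕ) := (Finset.range 4).biUnion fun q ↦ if (q + 1) * d < 5 then ∅ else
    ((univ : Finset (Fin (3 + 2))).finsuppAntidiag ((q + 1) * d - 5)).filter
      fun β : Fin (3 + 2) →₀ ℕ ↦ (∀ i, β i ≤ d - 2) ∧
        (∏ i, (((a : Fin (3 + 2) → ℂˣ) i : ℂˣ) : ℂ) ^ β i) = c with hT
  have hmemT : ∀ β : Fin (3 + 2) →₀ ℕ, β ∈ T ↔ (∀ i, β i ≤ d - 2) ∧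
      (∏ i, (((a : Fin (3 + 2) → ℂˣ) i : ℂˣ) : ℂ) ^ β i) = c ∧
      ∃ q, q < 4 ∧ 5 ≤ (q + 1) * d ∧ (univ : Finset (Fin (3 + 2))).sum ⇑β + 5 = (q + 1) * d := by
    intro β
    rw [hT, Finset.mem_biUnion]
    constructor
    · rintro ⟨q, hq, hβ⟩
      rw [Finset.mem_range] at hq
      split_ifs at hβ with hlt
      · exact absurd hβ (Finset.notMem_empty _)
      · rw [mem_filter, mem_finsuppAntidiag] at hβ
        obtain ⟨⟨hs, -⟩, hle, hc⟩ := hβ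
        exact ⟨hle, hc, q, hq, by omega, by omega⟩
    · rintro ⟨hle, hc, q, hq, h5, hs⟩
      refine ⟨q, Finset.mem_range.mpr hq, ?_⟩
      rw [if_neg (by omega), mem_filter, mem_finsuppAntidiag]
      exact ⟨⟨by omega, subset_univ _⟩, hle, hc⟩
  have hcardT : T.card = ∑ q ∈ Finset.range 4, if (q + 1) * d < 5 then 0 else
      (((univ : Finset (Fin (3 + 2))).finsuppAntidiag ((q + 1) * d - 5)).filter
        fun β : Fin (3 + 2) →₀ ℕ ↦ (∀ i, β i ≤ d - 2) ∧
          (∏ i, (((a : Fin (3 + 2) → ℂˣ) i : ℂˣ) : ℂ) ^ β i) = c).card := by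
    rw [hT, Finset.card_biUnion]
    · refine Finset.sum_congr rfl fun q _ ↦ ?_
      split_ifs <;> simp
    · intro q _ q' _ hqq'
      simp only [Function.onFun]
      split_ifs with h1 h2'
      · exact Finset.disjoint_empty_left _
      · exact Finset.disjoint_empty_left _
      · exact Finset.disjoint_empty_right _
      · refine Finset.disjoint_filter_filter (Finset.disjoint_left.mpr fun β hβ hβ' ↦ hqq' ?_)
        rw [mem_finsuppAntidiag] at hβ hβ'
        have h := hβ.1.symm.trans hβ'.1
        have hq1 : (q + 1) * d = (q' + 1) * d := by omega
        have := Nat.eq_of_mul_eq_mul_right hd0 hq1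
        omega
  -- the dictionary is a bijection between the admissible characters with `χ_α(a) = c` and `T`
  rw [Fintype.card_subtype, ← hcardT]
  refine card_nbij' toβ toα (fun α hα ↦ ?_) (fun β hβ ↦ ?_) (fun α hα ↦ ?_) (fun β hβ ↦ ?_)
  · -- `toβ` maps in
    rw [mem_coe, mem_filter] at hα
    obtain ⟨-, hc, hα0, hs⟩ := hα
    rw [mem_coe, hmemT]
    refine ⟨fun i ↦ by rw [htoβ_apply]; have := hval_lt (α i); omega, by rw [← hchar α hα0, hc], ?_⟩
    obtain ⟨m, hm⟩ := (hsum0 α).mp hs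
    have hsv := hsumval α hα0
    have hle : ∑ i, (α i).val ≤ 5 * (d - 1) := by
      calc ∑ i, (α i).val ≤ ∑ _i : Fin (3 + 2), (d - 1) := Finset.sum_le_sum fun i _ ↦ by
              have := hval_lt (α i); omega
        _ = 5 * (d - 1) := by rw [Finset.sum_const, Finset.card_univ, Fintype.card_fin, smul_eq_mul]
    have hm1 : 1 ≤ m := by
      rcases Nat.eq_zero_or_pos m with rfl | hmpos
      · rw [mul_zero] at hm; omega
      · exact hmpos
    have hm4 : m ≤ 4 := by
      by_contra hm5
      have : d * 5 ≤ d * m := Nat.mul_le_mul_left d (by omega)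
      omega
    refine ⟨m - 1, by omega, ?_, ?_⟩
    · rw [Nat.sub_add_cancel hm1, mul_comm]; omega
    · rw [Nat.sub_add_cancel hm1, mul_comm]
      have h : (univ : Finset (Fin (3 + 2))).sum ⇑(toβ α) = ∑ i, toβ α i := rfl
      omega
  · -- `toα` maps in
    rw [mem_coe, hmemT] at hβ
    obtain ⟨hle, hc, q, hq, h5, hs⟩ := hβ
    have hα0 : ∀ i, toα β i ≠ 0 := fun i ↦ htoα_ne β i (hle i)
    have hβα : toβ (toα β) = β := by
      ext i; rw [htoβ_apply, hval_toα β i (hle i)]; omega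
    rw [mem_coe, mem_filter]
    refine ⟨mem_univ _, by rw [hchar _ hα0, hβα, hc], hα0, ?_⟩
    rw [hsum0, hsumval _ hα0, hβα]
    have h : (univ : Finset (Fin (3 + 2))).sum ⇑β = ∑ i, β i := rfl
    exact ⟨q + 1, by rw [mul_comm]; omega⟩
  · -- `toα ∘ toβ = id` on admissible characters
    rw [mem_coe, mem_filter] at hα
    obtain ⟨-, -, hα0, -⟩ := hα
    funext i
    rw [htoα_apply, htoβ_apply, Nat.sub_add_cancel (hval_pos (hα0 i)), ZMod.natCast_zmod_val]
  · -- `toβ ∘ toα = id` on the box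
    rw [mem_coe, hmemT] at hβ
    ext i; rw [htoβ_apply, hval_toα β i (hβ.1 i)]; omega

end Summit.HodgeConjecture.HodgeConjecture.Theorems.SignSymmetricPowersSignFermatCount

end
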